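import Summits.Ventures.PercRepro.RankDistWeighted

/-!
# PercRepro — rank deficiency below the hyperplanes and the coline criterion (p9, gen 17)

`CogirthRLS` proved C-025 at `(p, q)` under rank deficiency at `(p, q)`: every set of rank `u < p` has at least
`p + q − u` rank-increasing elements. The chain of `RankDistWeighted` (`rls_of_step`) uses the levels `q ≤ u ≤ p − 2`
only, so the hypothesis is needed on the sets of rank `≤ p − 2` alone:
* `RankDeficientBelow M p q` (nothing is asked of the sets of rank `p − 1`) and **`rls_of_rankDeficientBelow`**;
* the chain `ncard_compl_closure_chain` from any level `t ≤ ρ(E)` down, and **`rls_of_colines`**: C-025 at `(p, q)`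
  on every finite matroid (`p ≤ ρ(E)`) in which every set of rank `p − 2` has at least `q + 2` elements of `E`
  outside its closure — for `p = ρ(E)`, every coline misses `≥ q + 2` points. Cogirth `≥ q + 1` implies it
  (`rls_of_cogirth` is the special case); `T_9(U_{8,10} ⊕ U_{7,7})` at `(9, 7)` satisfies it and not the cogirth
  hypothesis (its fat hyperplane `U_{8,10}` has nullity `2 > 1 = d − q`; its rank-`7` flats are independent).
Nothing here is a statement about any window of the crux: every theorem is a criterion on the matroid.
-/

namespace PercRepro.RankDist

open Set Finset Matroid

variable {α : Type}

/-! ### Rank deficiency below the hyperplanes -/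

/-- **Rank deficiency below the hyperplanes**: every `A ⊆ E` of rank `≤ p − 2` has at least `p + q − ρ(A)`
rank-increasing elements. `RankDeficient M p q` asks the same of the sets of rank `p − 1` as well. -/
def RankDeficientBelow (M : Matroid α) [M.Finite] (p q : ℕ) : Prop :=
  ∀ A ⊆ M.E, M.eRk A + 2 ≤ (p : ℕ∞) → p + q ≤ rk M A + (extSet M A).card

/-- Rank deficiency gives rank deficiency below the hyperplanes. -/
theorem rankDeficientBelow_of_rankDeficient (M : Matroid α) [M.Finite] (p q : ℕ)
    (hdef : RankDeficient M p q) : RankDeficientBelow M p q := by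
  intro A hA hlt
  refine hdef A hA ?_
  rw [eRk_eq_coe_rk M hA] at hlt ⊢
  have : rk M A + 2 ≤ p := by exact_mod_cast hlt
  exact_mod_cast (by omega : rk M A < p)

/-- Rank deficiency below the hyperplanes gives weighted rank deficiency (`κ(A) + 1 ≤ ρ(A) + 1`). -/
theorem weightedDeficient_of_rankDeficientBelow (M : Matroid α) [M.Finite] (p q : ℕ)
    (hdef : RankDeficientBelow M p q) : WeightedDeficient M p q := by
  intro A hA _ hAp
  have h := hdef A hA (by rw [eRk_eq_coe_rk M hA]; exact_mod_cast hAp)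
  have hκ := card_coloopSet_le M hA
  calc (p + q - rk M A) * ((coloopSet M A).card + 1)
      ≤ (p + q - rk M A) * (rk M A + 1) := Nat.mul_le_mul_left _ (by omega)
    _ = (rk M A + 1) * (p + q - rk M A) := mul_comm _ _
    _ ≤ (rk M A + 1) * (extSet M A).card := Nat.mul_le_mul_left _ (by omega)

/-- **C-025 UNDER RANK DEFICIENCY BELOW THE HYPERPLANES**: the hypothesis of `rls_of_rankDeficient` restricted to
the sets of rank `≤ p − 2` suffices. -/
theorem rls_of_rankDeficientBelow (M : Matroid α) [M.Finite] (p q : ℕ) (hdef : RankDeficientBelow M p q) :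
    ThmN.RLS M p q :=
  rls_of_weightedDeficient M p q (weightedDeficient_of_rankDeficientBelow M p q hdef)

/-- The closure form of rank deficiency below the hyperplanes. -/
theorem rankDeficientBelow_of_closure (M : Matroid α) [M.Finite] (p q : ℕ)
    (h : ∀ A ⊆ M.E, M.eRk A + 2 ≤ (p : ℕ∞) → p + q ≤ rk M A + (M.E \ M.closure A).ncard) :
    RankDeficientBelow M p q := by
  classical
  intro A hA hlt
  refine (h A hA hlt).trans (Nat.add_le_add_left ?_ _)
  have hsub : (M.E \ M.closure A) ⊆ ↑(extSet M A) := by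
    intro e he
    rw [Finset.mem_coe, mem_extSet]
    exact ⟨he.1, Matroid.eRk_insert_eq_add_one he⟩
  have := Set.ncard_le_ncard hsub (Finset.finite_toSet _)
  rwa [Set.ncard_coe_finset] at this

/-- The chain below a level `t ≤ ρ(E)`: if every set of rank `t` misses at least `m` elements of `E` in its
closure, a set of rank `t − k` misses at least `m + k`. -/
theorem ncard_compl_closure_chain (M : Matroid α) [M.Finite] (t m : ℕ) (ht : (t : ℕ∞) ≤ M.eRank)
    (hbase : ∀ A ⊆ M.E, M.eRk A = (t : ℕ∞) → m ≤ (M.E \ M.closure A).ncard) :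
    ∀ k : ℕ, ∀ A ⊆ M.E, M.eRk A + (k : ℕ∞) = (t : ℕ∞) → m + k ≤ (M.E \ M.closure A).ncard := by
  intro k
  induction k with
  | zero =>
    intro A hA h
    rw [Nat.cast_zero, add_zero] at h
    exact hbase A hA h
  | succ k ih =>
    intro A hA h
    have hlt : M.eRk A < M.eRank := by
      refine lt_of_lt_of_le ?_ ht
      rw [← h, eRk_eq_coe_rk M hA]
      norm_cast
      omega
    obtain ⟨e, heE, hecl⟩ := exists_notMem_closure M hlt
    have hA' : insert e A ⊆ M.E := Set.insert_subset heE hA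
    have hrk : M.eRk (insert e A) = M.eRk A + 1 := Matroid.eRk_insert_eq_add_one ⟨heE, hecl⟩
    have h' : M.eRk (insert e A) + (k : ℕ∞) = (t : ℕ∞) := by
      rw [hrk, ← h]; push_cast; ring
    have ih' := ih (insert e A) hA' h'
    have hsub : M.E \ M.closure (insert e A) ⊆ M.E \ M.closure A :=
      Set.sdiff_subset_sdiff_right (M.closure_subset_closure (Set.subset_insert _ _))
    have hecl' : e ∈ M.closure (insert e A) := M.mem_closure_of_mem' (Set.mem_insert _ _) heE
    have hnot : e ∉ M.E \ M.closure (insert e A) := fun h => h.2 hecl'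
    have hins : insert e (M.E \ M.closure (insert e A)) ⊆ M.E \ M.closure A :=
      Set.insert_subset ⟨heE, hecl⟩ hsub
    have hfin : (M.E \ M.closure A).Finite := M.ground_finite.subset Set.sdiff_subset
    have := Set.ncard_le_ncard hins hfin
    rw [Set.ncard_insert_of_notMem hnot (hfin.subset hsub)] at this
    omega

/-- **The colines give rank deficiency below the hyperplanes**: for `p ≤ ρ(E)`, if every set of rank `p − 2` has
at least `q + 2` elements of `E` outside its closure, then `M` is rank deficient at `(p, q)` below the
hyperplanes. -/
theorem rankDeficientBelow_of_colines (M : Matroid α) [M.Finite] (p q r : ℕ) (hr : M.eRank = (r : ℕ∞))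
    (hp : p ≤ r) (hcol : ∀ A ⊆ M.E, M.eRk A + 2 = (p : ℕ∞) → q + 2 ≤ (M.E \ M.closure A).ncard) :
    RankDeficientBelow M p q := by
  refine rankDeficientBelow_of_closure M p q fun A hA hlt => ?_
  rw [eRk_eq_coe_rk M hA] at hlt
  have hlt' : rk M A + 2 ≤ p := by exact_mod_cast hlt
  have ht : ((p - 2 : ℕ) : ℕ∞) ≤ M.eRank := by
    rw [hr]; exact_mod_cast (by omega : p - 2 ≤ r)
  have hbase : ∀ B ⊆ M.E, M.eRk B = ((p - 2 : ℕ) : ℕ∞) → q + 2 ≤ (M.E \ M.closure B).ncard := by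
    intro B hB hBr
    refine hcol B hB ?_
    rw [hBr]
    exact_mod_cast (by omega : p - 2 + 2 = p)
  have hchain := ncard_compl_closure_chain M (p - 2) (q + 2) ht hbase (p - 2 - rk M A) A hA (by
    rw [eRk_eq_coe_rk M hA]
    exact_mod_cast (by omega : rk M A + (p - 2 - rk M A) = p - 2))
  omega

/-- **C-025 ON EVERY MATROID WHOSE RANK-`(p − 2)` SETS MISS AT LEAST `q + 2` POINTS**: for `p ≤ ρ(E)` (the
crux's pairs are `q + 2 ≤ p`), if every set of rank `p − 2` has at least `q + 2` elements of `E` outside its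
closure — for `p = ρ(E)`: every coline misses `≥ q + 2` points, every union of two cocircuits of a common coline
has `≥ q + 2` elements — then `ThmN.RLS M p q`. Cogirth `≥ q + 1` (`rls_of_cogirth`) implies the hypothesis. -/
theorem rls_of_colines (M : Matroid α) [M.Finite] (p q r : ℕ) (hr : M.eRank = (r : ℕ∞)) (hp : p ≤ r)
    (hcol : ∀ A ⊆ M.E, M.eRk A + 2 = (p : ℕ∞) → q + 2 ≤ (M.E \ M.closure A).ncard) : ThmN.RLS M p q :=
  rls_of_rankDeficientBelow M p q (rankDeficientBelow_of_colines M p q r hr hp hcol)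

end PercRepro.RankDist
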